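import Mathlib.Combinatorics.SimpleGraph.AdjMatrix
import Literature.Combinatorics.SimpleGraph.FKVertexForm
import HarnessLib

/-!
# Kunisky–Yu §3.1/§3.4: the pair block `H^{2,2}` of the filled matrix, as sums over vertices

Continuation of `FKVertexForm.lean` (Kunisky–Yu 2022, arXiv:2211.02713). For an arbitrary finite
graph `G` we evaluate the entries `H({a,b},{c,d})` of KY (37) and rewrite the pair part
`F = ¼ Σ_{a,b,c,d} Vm_{ab} Vm_{cd} H({a,b},{c,d})` of the vertex form (for `Vm` symmetric with
zero diagonal) through the adjacency matrix `A = G.adjMatrix ℝ`: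

* `kyEntry_pair_pair_self`, `kyEntry_pair_pair_overlap`, `kyEntry_pair_pair_disjoint` — KY (37):
  `H = α₂ − α₂²` on equal pairs, `α₃ 1_{2,2} − α₂² = α₃ A_{bd} − α₂²` on pairs `{a,b}, {a,d}`
  sharing one vertex, `α₄ A_{ac}A_{ad}A_{bc}A_{bd} − α₂²` on disjoint pairs.
* `mul_mul_kyEntry_pair_pair` — the three cases in one polynomial formula (valid whenever
  `Vm_{aa} = 0`), and
* `pairBlock_eq` — **`F = −(α₂²/4)σ₀² + (α₂/2)N₂ + α₃·tr(Vm A Vm) + (α₄/4)·Q₄`** with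
  `σ₀ = Σ_{ab} Vm_{ab}`, `N₂ = Σ_{ab} Vm_{ab}²`, `tr(Vm A Vm) = Σ_{a,b,d} Vm_{ab}A_{bd}Vm_{da}` and
  `Q₄ = Σ_{a,b,c,d} Vm_{ab}Vm_{cd}A_{ac}A_{ad}A_{bc}A_{bd}` (the graph-matrix expansion (52)/(54)
  of KY before passing from `A = (J − I + S)/2` to the Seidel matrix `S`).

## References

* [KuniskyYu2022] D. Kunisky, X. Yu, arXiv:2211.02713, (37), (52), (54).
-/

noncomputable section

namespace Literature.Combinatorics.SimpleGraph

open Matrix Finset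

section PairBlock

variable {V : Type*} [Fintype V] [DecidableEq V] (G : _root_.SimpleGraph V) [DecidableRel G.Adj]

omit [Fintype V] in
/-- **KY (37), equal pairs**: `H({a,b},{a,b}) = α₂ − α₂²`. [cite: KuniskyYu2022, (37)] -/
theorem kyEntry_pair_pair_self (α : ℕ → ℝ) {a b : V} (hab : a ≠ b) :
    kyEntry G α {a, b} {a, b} = α 2 - α 2 * α 2 := by
  rw [kyEntry, union_self, card_pair hab, bipInd_apply, if_pos (by simp), mul_one]

omit [Fintype V] in
/-- **KY (37), pairs sharing one vertex**: for distinct `x, y, z`,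
`H({x,y},{x,z}) = α₃ 1_{2,2}({x,y},{x,z}) − α₂² = α₃ A_{yz} − α₂²`. [cite: KuniskyYu2022, (37)] -/
theorem kyEntry_pair_pair_overlap (α : ℕ → ℝ) {x y z : V} (hxy : x ≠ y) (hxz : x ≠ z)
    (hyz : y ≠ z) :
    kyEntry G α {x, y} {x, z} = α 3 * G.adjMatrix ℝ y z - α 2 * α 2 := by
  have hu : ({x, y} : Finset V) ∪ {x, z} = {x, y, z} := by
    ext v; simp only [mem_union, mem_insert, mem_singleton]; tauto
  have hc : ({x, y, z} : Finset V).card = 3 := card_eq_three.2 ⟨x, y, z, hxy, hxz, hyz, rfl⟩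
  have hs1 : ({x, y} : Finset V) \ {x, z} = {y} := by
    ext v; simp only [mem_sdiff, mem_insert, mem_singleton]
    constructor
    · rintro ⟨h1 | h1, h2⟩
      · exact absurd (Or.inl h1) h2
      · exact h1
    · intro h; subst h; exact ⟨Or.inr rfl, fun h => h.elim (fun h => hxy h.symm) hyz⟩
  have hs2 : ({x, z} : Finset V) \ {x, y} = {z} := by
    ext v; simp only [mem_sdiff, mem_insert, mem_singleton]
    constructor
    · rintro ⟨h1 | h1, h2⟩
      · exact absurd (Or.inl h1) h2
      · exact h1
    · intro h; subst h
      exact ⟨Or.inr rfl, fun h => h.elim (fun h => hxz h.symm) (fun h => hyz h.symm)⟩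
  rw [kyEntry, hu, hc, card_pair hxy, card_pair hxz, bipInd_apply, hs1, hs2,
    SimpleGraph.adjMatrix_apply]
  simp only [mem_singleton, forall_eq]

omit [Fintype V] in
/-- **KY (37), disjoint pairs**:
`H({a,b},{c,d}) = α₄ 1_{2,2} − α₂² = α₄ A_{ac}A_{ad}A_{bc}A_{bd} − α₂²`.
[cite: KuniskyYu2022, (37)] -/
theorem kyEntry_pair_pair_disjoint (α : ℕ → ℝ) {a b c d : V} (hab : a ≠ b) (hcd : c ≠ d)
    (hac : a ≠ c) (had : a ≠ d) (hbc : b ≠ c) (hbd : b ≠ d) :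
    kyEntry G α {a, b} {c, d} =
      α 4 * (G.adjMatrix ℝ a c * G.adjMatrix ℝ a d * G.adjMatrix ℝ b c * G.adjMatrix ℝ b d) -
        α 2 * α 2 := by
  have hdis : Disjoint ({a, b} : Finset V) {c, d} := by
    rw [Finset.disjoint_left]
    intro v hv1 hv2
    simp only [mem_insert, mem_singleton] at hv1 hv2
    rcases hv1 with rfl | rfl <;> rcases hv2 with h | h
    · exact hac h
    · exact had h
    · exact hbc h
    · exact hbd h
  have hcard : (({a, b} : Finset V) ∪ {c, d}).card = 4 := by
    rw [card_union_of_disjoint hdis, card_pair hab, card_pair hcd]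
  have hs1 : ({a, b} : Finset V) \ {c, d} = {a, b} := sdiff_eq_self_of_disjoint hdis
  have hs2 : ({c, d} : Finset V) \ {a, b} = {c, d} := sdiff_eq_self_of_disjoint hdis.symm
  rw [kyEntry, hcard, card_pair hab, card_pair hcd, bipInd_apply, hs1, hs2]
  simp only [mem_insert, mem_singleton, forall_eq_or_imp, forall_eq, SimpleGraph.adjMatrix_apply]
  by_cases h1 : G.Adj a c <;> by_cases h2 : G.Adj a d <;> by_cases h3 : G.Adj b c <;>
    by_cases h4 : G.Adj b d <;> simp [h1, h2, h3, h4]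

omit [Fintype V] in
/-- **The three cases of KY (37) in one polynomial formula.** For a matrix `Vm` with zero diagonal
and all vertices `a, b, c, d`:
`Vm_{ab}Vm_{cd}·H({a,b},{c,d}) = Vm_{ab}Vm_{cd}·( −α₂² + α₂([a=c][b=d] + [a=d][b=c])
  + α₃([a=c]A_{bd} + [b=d]A_{ac} + [a=d]A_{bc} + [b=c]A_{ad}) + α₄ A_{ac}A_{ad}A_{bc}A_{bd} )`
(the terms with `a = b` or `c = d` vanish on both sides; on distinct pairs exactly one summand
survives, by irreflexivity `A_{xx} = 0`). [cite: KuniskyYu2022, (37)] -/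
theorem mul_mul_kyEntry_pair_pair (α : ℕ → ℝ) (Vm : Matrix V V ℝ) (hVd : ∀ a, Vm a a = 0)
    (a b c d : V) :
    Vm a b * Vm c d * kyEntry G α {a, b} {c, d} = Vm a b * Vm c d *
      (-(α 2 * α 2) +
        α 2 * ((if a = c then 1 else 0) * (if b = d then 1 else 0) +
          (if a = d then 1 else 0) * (if b = c then 1 else 0)) +
        α 3 * ((if a = c then 1 else 0) * G.adjMatrix ℝ b d +
          (if b = d then 1 else 0) * G.adjMatrix ℝ a c +
          (if a = d then 1 else 0) * G.adjMatrix ℝ b c +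
          (if b = c then 1 else 0) * G.adjMatrix ℝ a d) +
        α 4 * (G.adjMatrix ℝ a c * G.adjMatrix ℝ a d * G.adjMatrix ℝ b c * G.adjMatrix ℝ b d)) := by
  have hA0 : ∀ x, G.adjMatrix ℝ x x = 0 := fun x => by simp [SimpleGraph.adjMatrix_apply]
  have hAs : ∀ x y, G.adjMatrix ℝ x y = G.adjMatrix ℝ y x := fun x y => by
    simp only [SimpleGraph.adjMatrix_apply, G.adj_comm]
  by_cases hab : a = b
  · subst hab; rw [hVd]; ring
  by_cases hcd : c = d
  · subst hcd; rw [hVd]; ring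
  congr 1
  by_cases hac : a = c
  · subst hac
    have had : ¬ a = d := hcd
    have hbc : ¬ b = a := fun h => hab h.symm
    by_cases hbd : b = d
    · subst hbd
      rw [kyEntry_pair_pair_self G α hab, if_pos rfl, if_pos rfl, if_neg had, if_neg hbc, hA0, hA0]
      ring
    · rw [kyEntry_pair_pair_overlap G α hab had hbd, if_pos rfl, if_neg hbd, if_neg had,
        if_neg hbc, hA0]
      ring
  by_cases had : a = d
  · subst had
    have hbc' : b ≠ c ∨ b = c := (em (b = c)).symm
    by_cases hbc : b = c
    · subst hbc
      rw [pair_comm b a, kyEntry_pair_pair_self G α hab, if_neg hac, if_pos rfl, if_pos rfl,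
        if_neg (Ne.symm hab), hA0, hA0]
      ring
    · rw [pair_comm c a, kyEntry_pair_pair_overlap G α hab hac hbc, if_neg hac, if_pos rfl,
        if_neg hbc, if_neg (fun h : b = a => hab h.symm), hA0]
      ring
  by_cases hbc : b = c
  · subst hbc
    rw [pair_comm a b, kyEntry_pair_pair_overlap G α (Ne.symm hab) hcd had, if_neg hac,
      if_neg had, if_pos rfl, if_neg (fun h : b = d => hcd h), hA0]
    ring
  by_cases hbd : b = d
  · subst hbd
    rw [pair_comm a b, pair_comm c b, kyEntry_pair_pair_overlap G α (Ne.symm hab) hbc hac,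
      if_neg hac, if_pos rfl, if_neg had, if_neg hbc, hA0]
    ring
  · rw [kyEntry_pair_pair_disjoint G α hab hcd hac had hbc hbd, if_neg hac, if_neg had, if_neg hbc,
      if_neg hbd]
    ring

/-- **The pair block through the adjacency matrix** (KY (52)/(54) before the substitution
`A = (J − I + S)/2`): for `Vm` symmetric with zero diagonal,
`¼ Σ_{a,b,c,d} Vm_{ab}Vm_{cd} H({a,b},{c,d})
   = −(α₂²/4)(Σ Vm)² + (α₂/2) Σ Vm² + α₃ Σ_{a,b,d} Vm_{ab}A_{bd}Vm_{da}
     + (α₄/4) Σ_{a,b,c,d} Vm_{ab}Vm_{cd}A_{ac}A_{ad}A_{bc}A_{bd}`.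
[cite: KuniskyYu2022, (52)–(54)] -/
theorem pairBlock_eq (α : ℕ → ℝ) (Vm : Matrix V V ℝ) (hVt : Vmᵀ = Vm) (hVd : ∀ a, Vm a a = 0) :
    (1 / 4) * ∑ a, ∑ b, ∑ c, ∑ d, Vm a b * Vm c d * kyEntry G α {a, b} {c, d} =
      -(α 2 ^ 2 / 4) * (∑ a, ∑ b, Vm a b) ^ 2 + α 2 / 2 * ∑ a, ∑ b, Vm a b ^ 2 +
        α 3 * ∑ a, ∑ b, ∑ d, Vm a b * G.adjMatrix ℝ b d * Vm d a +
        α 4 / 4 * ∑ a, ∑ b, ∑ c, ∑ d, Vm a b * Vm c d *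
          (G.adjMatrix ℝ a c * G.adjMatrix ℝ a d * G.adjMatrix ℝ b c * G.adjMatrix ℝ b d) := by
  have hVs : ∀ x y, Vm x y = Vm y x := fun x y => by
    have h := congrFun (congrFun hVt x) y
    rw [transpose_apply] at h
    exact h.symm
  set A := G.adjMatrix ℝ with hA
  set σ : ℝ := ∑ a, ∑ b, Vm a b with hσ
  -- the summand, split into pieces whose sums collapse
  have hpt : ∀ a b c d, Vm a b * Vm c d * kyEntry G α {a, b} {c, d} =
      -(α 2 * α 2) * (Vm a b * Vm c d) +
      (if b = d then (if a = c then α 2 * (Vm a b * Vm c d) else 0) else 0) +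
      (if a = d then (if b = c then α 2 * (Vm a b * Vm c d) else 0) else 0) +
      (if a = c then α 3 * (Vm a b * Vm c d * A b d) else 0) +
      (if b = d then α 3 * (Vm a b * Vm c d * A a c) else 0) +
      (if a = d then α 3 * (Vm a b * Vm c d * A b c) else 0) +
      (if b = c then α 3 * (Vm a b * Vm c d * A a d) else 0) +
      α 4 * (Vm a b * Vm c d * (A a c * A a d * A b c * A b d)) := by
    intro a b c d
    rw [mul_mul_kyEntry_pair_pair G α Vm hVd, hA]
    split_ifs <;> ring
  simp only [hpt, Finset.sum_add_distrib]
  -- piece 1: `Σ Vm_ab Vm_cd = σ²`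
  have p1 : ∑ a, ∑ b, ∑ c, ∑ d, -(α 2 * α 2) * (Vm a b * Vm c d) = -(α 2 * α 2) * σ ^ 2 := by
    have h1 : ∀ a b, ∑ c, ∑ d, -(α 2 * α 2) * (Vm a b * Vm c d) = -(α 2 * α 2) * (Vm a b * σ) := by
      intro a b
      rw [hσ, Finset.mul_sum, Finset.mul_sum]
      refine Finset.sum_congr rfl fun c _ => ?_
      rw [Finset.mul_sum, Finset.mul_sum]
    simp only [h1]
    have h2 : ∑ a, ∑ b, -(α 2 * α 2) * (Vm a b * σ) = -(α 2 * α 2) * σ * ∑ a, ∑ b, Vm a b := by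
      rw [Finset.mul_sum]
      refine Finset.sum_congr rfl fun a _ => ?_
      rw [Finset.mul_sum]
      exact Finset.sum_congr rfl fun b _ => by ring
    rw [h2, ← hσ]
    ring
  -- piece 2: `[a=c][b=d]`
  have p2 : ∑ a, ∑ b, ∑ c, ∑ d,
      (if b = d then (if a = c then α 2 * (Vm a b * Vm c d) else 0) else 0) =
        α 2 * ∑ a, ∑ b, Vm a b ^ 2 := by
    simp only [Finset.sum_ite_eq, mem_univ, if_true]
    rw [Finset.mul_sum]
    refine Finset.sum_congr rfl fun a _ => ?_
    rw [Finset.mul_sum]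
    exact Finset.sum_congr rfl fun b _ => by ring
  -- piece 3: `[a=d][b=c]`
  have p3 : ∑ a, ∑ b, ∑ c, ∑ d,
      (if a = d then (if b = c then α 2 * (Vm a b * Vm c d) else 0) else 0) =
        α 2 * ∑ a, ∑ b, Vm a b ^ 2 := by
    simp only [Finset.sum_ite_eq, mem_univ, if_true]
    rw [Finset.mul_sum]
    refine Finset.sum_congr rfl fun a _ => ?_
    rw [Finset.mul_sum]
    exact Finset.sum_congr rfl fun b _ => by rw [hVs b a]; ring
  -- piece 4: `[a=c] A_bd`
  have p4 : ∑ a, ∑ b, ∑ c, ∑ d, (if a = c then α 3 * (Vm a b * Vm c d * A b d) else 0) =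
      α 3 * ∑ a, ∑ b, ∑ d, Vm a b * A b d * Vm d a := by
    rw [Finset.mul_sum]
    refine Finset.sum_congr rfl fun a _ => ?_
    rw [Finset.mul_sum]
    refine Finset.sum_congr rfl fun b _ => ?_
    rw [Finset.sum_comm]
    simp only [Finset.sum_ite_eq, mem_univ, if_true, Finset.mul_sum]
    exact Finset.sum_congr rfl fun d _ => by rw [hVs d a]; ring
  -- piece 5: `[b=d] A_ac`
  have p5 : ∑ a, ∑ b, ∑ c, ∑ d, (if b = d then α 3 * (Vm a b * Vm c d * A a c) else 0) =
      α 3 * ∑ a, ∑ b, ∑ d, Vm a b * A b d * Vm d a := by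
    simp only [Finset.sum_ite_eq, mem_univ, if_true]
    -- `Σ_a Σ_b Σ_c Vm_ab Vm_cb A_ac`; rename to `Σ_b Σ_a Σ_c`
    rw [Finset.sum_comm, Finset.mul_sum]
    refine Finset.sum_congr rfl fun b _ => ?_
    rw [Finset.mul_sum]
    refine Finset.sum_congr rfl fun a _ => ?_
    rw [Finset.mul_sum]
    exact Finset.sum_congr rfl fun c _ => by rw [hVs b a]; ring
  -- piece 6: `[a=d] A_bc`
  have p6 : ∑ a, ∑ b, ∑ c, ∑ d, (if a = d then α 3 * (Vm a b * Vm c d * A b c) else 0) =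
      α 3 * ∑ a, ∑ b, ∑ d, Vm a b * A b d * Vm d a := by
    simp only [Finset.sum_ite_eq, mem_univ, if_true]
    rw [Finset.mul_sum]
    refine Finset.sum_congr rfl fun a _ => ?_
    rw [Finset.mul_sum]
    refine Finset.sum_congr rfl fun b _ => ?_
    rw [Finset.mul_sum]
    exact Finset.sum_congr rfl fun c _ => by ring
  -- piece 7: `[b=c] A_ad`
  have p7 : ∑ a, ∑ b, ∑ c, ∑ d, (if b = c then α 3 * (Vm a b * Vm c d * A a d) else 0) =
      α 3 * ∑ a, ∑ b, ∑ d, Vm a b * A b d * Vm d a := by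
    have inner : ∀ a b, ∑ c, ∑ d, (if b = c then α 3 * (Vm a b * Vm c d * A a d) else 0) =
        ∑ d, α 3 * (Vm a b * Vm b d * A a d) := by
      intro a b
      rw [Finset.sum_comm]
      simp only [Finset.sum_ite_eq, mem_univ, if_true]
    simp only [inner]
    -- `Σ_a Σ_b Σ_d Vm_ab Vm_bd A_ad`: rename `a ↔ b`... reorder to `Σ_b Σ_a Σ_d`
    rw [Finset.sum_comm, Finset.mul_sum]
    refine Finset.sum_congr rfl fun b _ => ?_
    rw [Finset.mul_sum]
    refine Finset.sum_congr rfl fun a _ => ?_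
    rw [Finset.mul_sum]
    exact Finset.sum_congr rfl fun d _ => by
      rw [hVs b a, hVs d b]
      ring
  -- piece 8: the `α₄` term
  have p8 : ∑ a, ∑ b, ∑ c, ∑ d, α 4 * (Vm a b * Vm c d * (A a c * A a d * A b c * A b d)) =
      α 4 * ∑ a, ∑ b, ∑ c, ∑ d, Vm a b * Vm c d * (A a c * A a d * A b c * A b d) := by
    simp only [Finset.mul_sum]
  rw [p1, p2, p3, p4, p5, p6, p7, p8]
  ring

end PairBlock

end Literature.Combinatorics.SimpleGraph

end
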